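import Mathlib
import Summits.Ventures.PercRepro2.KPrimeReduction
import Summits.Ventures.PercRepro2.KPrimeSure
import Summits.Ventures.PercRepro2.KPrimeInduction
import Summits.Ventures.PercRepro2.KPrimeVInduction
import Summits.Ventures.PercRepro2.KPrimeLambdaDefs
import Summits.Ventures.PercRepro2.KPrimeLambdaEdges

/-!
# The `Λ`-induction along the `v`-exploration: `(STEP-Λ′) ⟹ Λ ≥ 0 ⟹ (K′)`
(blind cell PercRepro2, mine-c g33; `conjectures/MINE-C.md` §42.8–42.9)

With the potential `Λ = Φ_K − base` (`KPrimeLambdaDefs.lean`) the `v`-exploration closes: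

  `(STEP-Λ′)  Λ ≥ 0 at p[e ↦ 0] → Λ ≥ 0 at p[e ↦ 1] → Λ ≥ 0 at p`

for every unresolved edge `e = {x, z}` leaving the weight-`1` root of `v` into `z` outside the roots
of `a₁` and `a₂` (`IsUnresolvedVRootEdge`, `KPrimeVInduction.lean`).

**Theorem** (`lam_of_lamstep`): `(STEP-Λ′)` for every instance implies `Λ ≥ 0` for every instance,
by strong induction on the number of unresolved edges — the base case `lam_of_exhausted_v`, the
degenerate cases `lamHolds_of_a₁_mem_root_v` / `_a₂_`, the special edges `lamHolds_of_update_zero_va₁`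
/ `_va₂` (all `KPrimeLambdaEdges.lean`); and **`kprime_of_lamstep`**: `(STEP-Λ′) ⟹ (K′)` for every
instance (`kprimeHolds_of_lamHolds`).

`(STEP-Λ′)` is NOT proved here.  Its brace form «the mixture defect of `Λ` is `≥ 0` at every
`v`-root edge» — `dΛ = dΦ + π·base¹` — is census-true under the adversarial weight climb on every
graph with `≤ 8` vertices (`MINE-C.md` §42.8: 45,265 climbs, 0 negative), where the brace forms of
the three earlier one-edge statements of this lane fail; it is the one open statement.
-/

namespace Summit.Ventures.PercRepro2

namespace KPrime

variable {V : Type*} {E : Type*} [Fintype E] [DecidableEq E] [Fintype V] [DecidableEq V]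
  {R : Type*} [Field R] [LinearOrder R] [IsStrictOrderedRing R]

section LamInduction

variable (ends : E → Sym2 V) (a₁ a₂ b v y : V)

/-- **(STEP-Λ′)** — the one-edge statement of the `Λ`-induction: at every instance and every
unresolved `v`-root edge `e` (into `z` outside the roots of `a₁`, `a₂`), `Λ ≥ 0` for the two
resolutions implies `Λ ≥ 0` for the instance.  NOT proved here (`MINE-C.md` §42.8). -/
def StepLam : Prop :=
  ∀ p : E → R, IsProbVec p → ∀ e, IsUnresolvedVRootEdge ends a₁ a₂ v p e →
    LamHolds (Function.update p e 0) ends a₁ a₂ b v y →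
      LamHolds (Function.update p e 1) ends a₁ a₂ b v y →
        LamHolds p ends a₁ a₂ b v y

/-- **THE `Λ`-INDUCTION**: `(STEP-Λ′)` for every instance implies `Λ ≥ 0` for every instance. -/
theorem lam_of_lamstep (hstep : StepLam (R := R) ends a₁ a₂ b v y) :
    ∀ p : E → R, IsProbVec p → LamHolds p ends a₁ a₂ b v y := by
  intro p
  induction' hn : unres p using Nat.strong_induction_on with n ih generalizing p
  intro hp
  by_cases h1r : a₁ ∈ root p ends v
  · exact lamHolds_of_a₁_mem_root_v h1r
  by_cases h2r : a₂ ∈ root p ends v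
  · exact lamHolds_of_a₂_mem_root_v h2r
  by_cases hre : ∃ e, IsUnresolvedVRootEdge ends a₁ a₂ v p e
  · obtain ⟨e, x, z, hends, hx, hz, hz1, hz2, h0, h1⟩ := hre
    have ih0 := ih _ (hn ▸ unres_update_lt h0 h1 (Or.inl rfl)) (Function.update p e 0) rfl
      (hp.update e le_rfl zero_le_one)
    have ih1 := ih _ (hn ▸ unres_update_lt h0 h1 (Or.inr rfl)) (Function.update p e 1) rfl
      (hp.update e zero_le_one le_rfl)
    exact hstep p hp e ⟨x, z, hends, hx, hz, hz1, hz2, h0, h1⟩ ih0 ih1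
  simp only [not_exists] at hre
  by_cases hea : ∃ e x z, ends e = s(x, z) ∧ x ∈ root p ends v ∧ z ∈ root p ends a₁ ∧
      p e ≠ 0 ∧ p e ≠ 1
  · obtain ⟨e, x, z, hends, hx, hz, h0, h1⟩ := hea
    have ih0 := ih _ (hn ▸ unres_update_lt h0 h1 (Or.inl rfl)) (Function.update p e 0) rfl
      (hp.update e le_rfl zero_le_one)
    exact lamHolds_of_update_zero_va₁ hp hends hx hz h1r h1 ih0
  by_cases heb : ∃ e x z, ends e = s(x, z) ∧ x ∈ root p ends v ∧ z ∈ root p ends a₂ ∧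
      p e ≠ 0 ∧ p e ≠ 1
  · obtain ⟨e, x, z, hends, hx, hz, h0, h1⟩ := heb
    have ih0 := ih _ (hn ▸ unres_update_lt h0 h1 (Or.inl rfl)) (Function.update p e 0) rfl
      (hp.update e le_rfl zero_le_one)
    exact lamHolds_of_update_zero_va₂ hp hends hx hz h2r h1 ih0
  have hex : Exhausted p ends v := by
    intro e x z hends hx hz
    by_contra h0
    have h1 : p e ≠ 1 := fun h1 => hz (mem_root_of_one p hends hx h1)
    by_cases hz1 : z ∈ root p ends a₁
    · exact hea ⟨e, x, z, hends, hx, hz1, h0, h1⟩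
    by_cases hz2 : z ∈ root p ends a₂
    · exact heb ⟨e, x, z, hends, hx, hz2, h0, h1⟩
    exact hre e ⟨x, z, hends, hx, hz, hz1, hz2, h0, h1⟩
  exact lam_of_exhausted_v hp hex h1r h2r

/-- **`(STEP-Λ′) ⟹ (K′)`** for every instance. -/
theorem kprime_of_lamstep (hstep : StepLam (R := R) ends a₁ a₂ b v y) :
    ∀ p : E → R, IsProbVec p → KPrimeHolds ends a₁ a₂ b v y p :=
  fun p hp => kprimeHolds_of_lamHolds hp (lam_of_lamstep ends a₁ a₂ b v y hstep p hp)

end LamInduction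

end KPrime

end Summit.Ventures.PercRepro2
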